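import Summits.KontsevichZagierPeriods.KontsevichZagierPeriods.Theses.TorsionLogs
import Summits.KontsevichZagierPeriods.KontsevichZagierPeriods.Theorems.TorsionLogsNeronTorsionSectorAssemblyMain
import Literature.NumberTheory.Transcendental.KZProductIdeal

/-!
# F3 WITNESS — line `NeronHaar` on crux `TorsionSectorComplete` (stmt-KontsevichZagierPeriods-14212), fwd2-rung gen 20

The rung is the family `NeronHaarMember : Bool → Prop` — member `false` := the floor decl
`Theses.TorsionLogs.NeronTorsionPrimitiveChain` VERBATIM (evaluation at a real torsion point; the seed, CLOSED), member
`true` := `NeronHaarSector` (evaluation against Haar measure of the identity component); the rung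
`NeronTorsionHaar := ∀ b, NeronHaarMember b`.  The floor specialises the rung at the parameter `b := false`: the seed theorem
`Cruxes.NeronTorsionSector.Translation.stub_assembly` (route link `Theses.TorsionLogs.NeronTorsionPrimitiveChain_holds`) proves it.
No `sorry`.  Self-contained: verbatim copies of the three `def`s of `Lines/NeronHaar.lean` in the namespace `…NeronHaar.Special`.
-/

noncomputable section

open Set MeasureTheory
open Literature.NumberTheory.Transcendental
open Summit.KontsevichZagierPeriods.KontsevichZagierPeriods.Theses.TorsionLogs (NeronTorsionPrimitiveChain
  NeronTorsionPrimitiveChain_holds TorsionSectorComplete)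
open Summit.KontsevichZagierPeriods.KontsevichZagierPeriods.Cruxes.NeronTorsionSector.Translation (stub_assembly)

set_option linter.dupNamespace false

namespace Summit.KontsevichZagierPeriods.KontsevichZagierPeriods.Cruxes.TorsionSectorComplete.NeronHaar.Special

/-- **Member `true`: the TIED HAAR SECTOR STATEMENT.**  For the floor's curve data verbatim (real cubic
`f = 4x³ − g₂x − g₃`, `g₂³ ≠ 27g₃²`, largest root `e₁ > 0`, `f > 0` beyond) and representations pinned as
`r3O = [e₁<z₂<z₁<z₀, z₂/(√f√f√f)]` (`= L₃(O)`), `rEta = [(e₁,∞), (g₂t+2g₃)/(2t²√f)]` (`= η₁`), `rA = [(e₁,∞), 1/√f]`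
(`= ω₁/2`), `rN = [{f < 0}, 1/√(−f)]` (`= Im ω₂`), `rB = [1<t<B, 1/t]` (`B > 1`), `[π] = KZ.piRep`, every integer `c`
satisfying the VALUE HYPOTHESIS gives an element of `KZ.relations`.
[cite: KontsevichZagier2001, §1.2] [cite: SilvermanATAEC1994, VI Thm 3.4, VI Thm 4.2] [cite: Lang1983, Ch. 13] -/
def NeronHaarSector : Prop :=
  ∀ (g₂ g₃ e₁ B : ℝ) (c : ℤ) (f : ℝ → ℝ),
    (∀ x, f x = 4 * x ^ 3 - g₂ * x - g₃) → g₂ ^ 3 - 27 * g₃ ^ 2 ≠ 0 → f e₁ = 0 → 0 < e₁ →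
    (∀ x, e₁ < x → 0 < f x) → 1 < B →
    ∀ (r3O : KZ.IntegralRep 3) (rEta rA rN rB : KZ.IntegralRep 1),
    r3O.domain = {z | e₁ < z 2 ∧ z 2 < z 1 ∧ z 1 < z 0} →
    Set.EqOn r3O.integrand
      (fun z => z 2 / (Real.sqrt (f (z 2)) * Real.sqrt (f (z 1)) * Real.sqrt (f (z 0)))) r3O.domain →
    rEta.domain = {t | e₁ < t 0} →
    Set.EqOn rEta.integrand (fun t => (g₂ * t 0 + 2 * g₃) / (2 * (t 0) ^ 2 * Real.sqrt (f (t 0)))) rEta.domain →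
    rA.domain = {t | e₁ < t 0} → Set.EqOn rA.integrand (fun t => (Real.sqrt (f (t 0)))⁻¹) rA.domain →
    rN.domain = {t | f (t 0) < 0} → Set.EqOn rN.integrand (fun t => (Real.sqrt (-f (t 0)))⁻¹) rN.domain →
    rB.domain = {t | 1 < t 0 ∧ t 0 < B} → Set.EqOn rB.integrand (fun t => (t 0)⁻¹) rB.domain →
    12 * r3O.value + rEta.value * rA.value * rA.value - Real.pi * rN.value - c * (rA.value * rB.value) = 0 →
    (12 : ℤ) • KZ.of r3O + KZ.of rEta * KZ.of rA * KZ.of rA - KZ.of KZ.piRep * KZ.of rN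
      - c • (KZ.of rA * KZ.of rB) ∈ KZ.relations

/-- **The family, indexed by the functional (`false` ↦ evaluation at a torsion point, `true` ↦ Haar measure).**
Member `false` is the floor decl `Theses.TorsionLogs.NeronTorsionPrimitiveChain` VERBATIM (the seed, CLOSED); member
`true` is `NeronHaarSector`. Honest containment: nothing else varies. -/
def NeronHaarMember : Bool → Prop
  | false => NeronTorsionPrimitiveChain
  | true => NeronHaarSector

/-- **THE RUNG `NeronTorsionHaar`: the torsion packets and their Haar limit.** -/
def NeronTorsionHaar : Prop := ∀ b : Bool, NeronHaarMember b


/-- Member `false` is the floor, definitionally. -/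
theorem false_iff : NeronHaarMember false ↔ NeronTorsionPrimitiveChain := Iff.rfl

/-- **F3: the floor is the rung's member `false`** — by the landed seed theorem `stub_assembly`. -/
example : NeronHaarMember false := by simpa [false_iff, NeronTorsionPrimitiveChain] using stub_assembly

/-- The same, as a term (member `false` is the floor decl by `rfl`, and `stub_assembly` proves the floor). -/
example : NeronHaarMember false := stub_assembly

/-- The same through the route link. -/
theorem rung_false : NeronHaarMember false := NeronTorsionPrimitiveChain_holds

/-- The rung is exactly `floor ∧ member true` (honest containment: the rung adds ONE statement to the floor). -/
theorem rung_iff : NeronTorsionHaar ↔ NeronTorsionPrimitiveChain ∧ NeronHaarSector := by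
  constructor
  · exact fun h => ⟨h false, h true⟩
  · rintro ⟨h₂, h₃⟩ (_ | _)
    · exact h₂
    · exact h₃

/-- Given the floor (a theorem), the rung is equivalent to its new member. -/
theorem rung_iff_true : NeronTorsionHaar ↔ NeronHaarMember true :=
  ⟨fun h => h true, fun h => rung_iff.mpr ⟨NeronTorsionPrimitiveChain_holds, h⟩⟩

end Summit.KontsevichZagierPeriods.KontsevichZagierPeriods.Cruxes.TorsionSectorComplete.NeronHaar.Special

end
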